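import Literature.MathematicalPhysics.QuantumFieldTheory.BorinskyMunchTellander2023.SymanzikProductFaces
import HarnessLib

/-!
# `max_{NP[ℱ(𝒫)]} ⟨−1_γ, ·⟩ = −z_ℱ(γ)` and the initial form of `ℱ(𝒫)` on EVERY face `−1_γ` under generic kinematics: `Ψ_γ ℱ_{G/γ}(𝒫)` off m.m., `ℱ_γ(𝒫) Ψ_{G/γ}` on m.m. — BMT23 Theorems 3.5 / 3.6 read ON THE FACES, Gram-matrix kinematics in every regime — PROVED

**Sources.** M. Borinsky, H. J. Munch, F. Tellander, CPC 292 (2023) 108874 = arXiv:2302.08955 [cite: BorinskyMunchTellander2023] —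
Theorem 3.5 (main.tex l.740–746: "z_ℱ(γ) = L_γ + 1 if γ is mass-momentum spanning and z_ℱ(γ) = L_γ otherwise"), Theorem 3.6
(l.766–772), §3.3 (m.m., `ℱ_{G/γ}`). M. Borinsky, arXiv:2008.12310 [cite: Borinsky2020] — Definition 1 (truncation), eq. (logPtr)
/ Proposition 7 (the support function `max_{v∈NP_p} ⟨y,v⟩`), Theorem 23 (`z(∅) = 0`), Theorem 32 and its proof ("follows
directly from the factorization laws"). F. Brown, arXiv:1512.06409 [cite: Brown2017] — Prop. 2.4, Thm 2.7. K. Schultka,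
arXiv:1806.01086 [cite: Schultka2018] — Corollary 4.12.

**What is typed (all PROVED; 0 definitions; 0 named facts).** `KinematicRegimes.lean` typed THM 3.6 as the EQUALITY OF POLYTOPES
`NP[ℱ(𝒫)] = 𝒢(z_ℱ)` under (generic kinematics); the companions typed the initial forms of `ℱ(𝒫)` on the faces `−1_γ` under
side conditions `ℱ_{G/γ}(𝒫) ≠ 0` (UV) / `ℱ_γ(𝒫) ≠ 0` (IR). This file joins the two: (1) `faceValue_eq_of_support_eq` (the support
function depends on the support only); (2) **`faceValue_gramSecondSymanzik_eq_gpSupport`** (generic kinematics, `ℱ(𝒫) ≠ 0`: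
`max_{supp ℱ(𝒫)} ⟨y,·⟩ = h_{z_ℱ}(y)` for EVERY `y`, transferred from the Euclidean auxiliary momenta of the companion); (3)
**`faceValue_gramSecondSymanzik_neg_setIndicator_eq_neg_zGram`**: `max ⟨−1_γ, ·⟩ = −z_ℱ(γ)`, i.e. `−L_γ` off m.m. and `−(L_γ + 1)`
on m.m. (`…_of_not_mm`, `…_of_mm`); (4) **`gramSecondSymanzikSub_ne_zero`**: under generic kinematics, for an m.m. `γ` and `ℱ(𝒫) ≠ 0`,
the subgraph polynomial `ℱ_γ(𝒫)` (read from a vertex reaching the external vertices inside `γ`) is NOT zero — so the IR side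
condition of the companion is automatic; (5) **`trunc_gramSecondSymanzik_neg_setIndicator_of_isMassMomentumSpanningGram`**: under
generic kinematics, for EVERY m.m. `γ`, `ℱ(𝒫)|_{F_{−1_γ}} = ℱ_γ(𝒫) · Ψ_{G/γ}` with NO side condition (when `ℱ(𝒫) = 0` both sides
vanish) — the m.m. branch of Theorem 3.5 / 3.6 read on the face, companion of `SecondSymanzikUVFace`'s
`trunc_gramSecondSymanzik_neg_setIndicator_of_not_isMassMomentumSpanningGram` (the other branch).

**Route (disclosed).** (2): supports of `ℱ(𝒫)` and of `Ξ_G(p̃)` for the auxiliary momenta coincide under generic kinematics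
(`support_gramSecondSymanzik_eq`), `z_Ξ(p̃) = z_ℱ(𝒫)` (`zSecondSymanzik_auxMomenta`), and the companion
`faceValue_secondSymanzikPolynomial_eq_gpSupport`. (3): `h_z(−1_γ) = −z(γ) + z(∅)` (`lovaszExt_setIndicator`) with `z(∅) = 0`
from `ℱ ≠ 0`. (4): a monomial attaining `−(L_γ+1)` has exactly `L_γ + 1` variables of `γ`, where the companion's coefficient
identity `coeff_eq_coeff_sub_mul_of_gammaDeg_eq` makes it a monomial of `ℱ_γ(𝒫) Ψ_{G/γ}`. READINGS as the companions (generic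
kinematics in the NON-EMPTY-proper-subset reading; m.m. combinatorial). D-0026: 0 facts.
-/

noncomputable section

namespace Literature.MathematicalPhysics.QuantumFieldTheory.BorinskyMunchTellander2023

open Finset MvPolynomial Matrix
open Literature.MathematicalPhysics.QuantumFieldTheory
open Literature.MathematicalPhysics.QuantumFieldTheory.Borinsky2020

variable {N V : ℕ} {E : Fin N → Fin (V + 1) × Fin (V + 1)} {P : Matrix (Fin (V + 1)) (Fin (V + 1)) ℝ}

/-- The support function `max_{ℓ ∈ supp p} ⟨y,ℓ⟩` depends on the support only. [cite: Borinsky2020, §2 (tropical.tex l.291) and eq. (logPtr) (l.415–419)] -/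
theorem faceValue_eq_of_support_eq {σ : Type*} {p q : MvPolynomial σ ℝ} (h : p.support = q.support) (y : σ → ℝ) :
    faceValue p y = faceValue q y := by
  by_cases hp : p = 0
  · have hq : q = 0 := by
      by_contra hq
      have := support_nonempty.2 hq
      rw [← h, support_nonempty] at this
      exact this hp
    rw [hp, hq]
  · have hq : q ≠ 0 := by
      have := support_nonempty.2 hp
      rw [h, support_nonempty] at this
      exact this
    apply le_antisymm
    · obtain ⟨d, hd, hdy⟩ := exists_pairing_eq_faceValue hp y
      rw [← hdy]
      rw [h] at hd
      exact pairing_le_faceValue hd y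
    · obtain ⟨d, hd, hdy⟩ := exists_pairing_eq_faceValue hq y
      rw [← hdy]
      rw [← h] at hd
      exact pairing_le_faceValue hd y

/-- **The support function of `NP[ℱ(𝒫)]` is `h_{z_ℱ}` under generic kinematics** (`ℱ(𝒫) ≠ 0`): `max_{ℓ ∈ supp ℱ(𝒫)} ⟨y,ℓ⟩ =
max_{v ∈ 𝒢(z_ℱ)} ⟨y,v⟩` for every `y` — Theorem 3.6's `NP[ℱ] = 𝒢(z_ℱ)` in support-function form, every regime.
[cite: BorinskyMunchTellander2023, Theorems 3.5 / 3.6 (main.tex l.740–746, l.766–772); Borinsky2020, eq. (logPtr) (tropical.tex l.415–419) and Theorem 32] -/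
theorem faceValue_gramSecondSymanzik_eq_gpSupport (hconn : IsConnectedEdgeList E) (hP : P.IsSymm)
    (hcons : ∀ u, ∑ v, P u v = 0) {m : Fin N → ℝ} (hgen : IsGeneric P m) (hℱ : gramSecondSymanzik E P m ≠ 0)
    (y : Fin N → ℝ) : faceValue (gramSecondSymanzik E P m) y = gpSupport (zGram E P m) y := by
  have hsupp := support_gramSecondSymanzik_eq hconn hP hcons hgen
  have hΞ : secondSymanzikPolynomial E (auxMomenta P) m ≠ 0 := by
    have := support_nonempty.2 hℱ
    rw [hsupp, support_nonempty] at this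
    exact this
  rw [faceValue_eq_of_support_eq hsupp, faceValue_secondSymanzikPolynomial_eq_gpSupport hconn (sum_auxMomenta P)
    (isGenericMomenta_auxMomenta hP hcons) hΞ y, zSecondSymanzik_auxMomenta hP hcons m]

/-- `z_ℱ(∅) = 0` as soon as `ℱ(𝒫) ≠ 0` (generic kinematics): Borinsky's normalisation `z(∅) = 0`.
[cite: Borinsky2020, Theorem 23 (tropical.tex l.1018) and Theorem 32; BorinskyMunchTellander2023, Theorem 3.5] -/
theorem zGram_empty_of_ne_zero (hconn : IsConnectedEdgeList E) (hP : P.IsSymm) (hcons : ∀ u, ∑ v, P u v = 0)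
    {m : Fin N → ℝ} (hgen : IsGeneric P m) (hℱ : gramSecondSymanzik E P m ≠ 0) : zGram E P m ∅ = 0 := by
  have hsupp := support_gramSecondSymanzik_eq hconn hP hcons hgen
  have hΞ : secondSymanzikPolynomial E (auxMomenta P) m ≠ 0 := by
    have := support_nonempty.2 hℱ
    rw [hsupp, support_nonempty] at this
    exact this
  rw [← zSecondSymanzik_auxMomenta hP hcons m]
  exact zSecondSymanzik_empty (not_isMassMomentumSpanning_empty_of_ne_zero (sum_auxMomenta P) hΞ)

/-- **`max_{NP[ℱ(𝒫)]} ⟨−1_γ, ·⟩ = −z_ℱ(γ)`** under generic kinematics (`ℱ(𝒫) ≠ 0`), every `γ`, every regime: the least number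
of `γ`-variables in a monomial of `ℱ(𝒫)` is `z_ℱ(γ) = L_γ + [γ m.m.]`. [cite: BorinskyMunchTellander2023, Theorems 3.5 / 3.6 (main.tex l.740–746, l.766–772); Borinsky2020, Theorem 32; Schultka2018, Proposition 4.11 (1) (deg_γ Φ_{G|γ} = h¹_γ + δ^{mm}_γ)] -/
theorem faceValue_gramSecondSymanzik_neg_setIndicator_eq_neg_zGram (hconn : IsConnectedEdgeList E) (hP : P.IsSymm)
    (hcons : ∀ u, ∑ v, P u v = 0) {m : Fin N → ℝ} (hgen : IsGeneric P m) (hℱ : gramSecondSymanzik E P m ≠ 0)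
    (γ : Finset (Fin N)) : faceValue (gramSecondSymanzik E P m) (-setIndicator γ) = -zGram E P m γ := by
  rw [faceValue_gramSecondSymanzik_eq_gpSupport hconn hP hcons hgen hℱ]
  have h := lovaszExt_setIndicator (fun A : Finset (Fin N) => -zGram E P m A) γ
  simp only [lovaszExt, neg_neg] at h
  rw [zGram_empty_of_ne_zero hconn hP hcons hgen hℱ, neg_zero, sub_zero] at h
  exact h

/-- The non-m.m. branch: `max_{NP[ℱ(𝒫)]} ⟨−1_γ, ·⟩ = −L_γ`. [cite: BorinskyMunchTellander2023, Theorem 3.5 ("z_ℱ(γ) = L_γ otherwise")] -/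
theorem faceValue_gramSecondSymanzik_neg_setIndicator_of_not_mm (hconn : IsConnectedEdgeList E) (hP : P.IsSymm)
    (hcons : ∀ u, ∑ v, P u v = 0) {m : Fin N → ℝ} (hgen : IsGeneric P m) (hℱ : gramSecondSymanzik E P m ≠ 0)
    {γ : Finset (Fin N)} (hnot : ¬ IsMassMomentumSpanningGram E P m γ) :
    faceValue (gramSecondSymanzik E P m) (-setIndicator γ) = -(loopNumber E γ : ℝ) := by
  rw [faceValue_gramSecondSymanzik_neg_setIndicator_eq_neg_zGram hconn hP hcons hgen hℱ, zGram, if_neg hnot, add_zero]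

/-- The m.m. branch: `max_{NP[ℱ(𝒫)]} ⟨−1_γ, ·⟩ = −(L_γ + 1)`. [cite: BorinskyMunchTellander2023, Theorem 3.5 ("z_ℱ(γ) = L_γ + 1 if γ is mass-momentum spanning")] -/
theorem faceValue_gramSecondSymanzik_neg_setIndicator_of_mm (hconn : IsConnectedEdgeList E) (hP : P.IsSymm)
    (hcons : ∀ u, ∑ v, P u v = 0) {m : Fin N → ℝ} (hgen : IsGeneric P m) (hℱ : gramSecondSymanzik E P m ≠ 0)
    {γ : Finset (Fin N)} (hmm : IsMassMomentumSpanningGram E P m γ) :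
    faceValue (gramSecondSymanzik E P m) (-setIndicator γ) = -((loopNumber E γ + 1 : ℕ) : ℝ) := by
  rw [faceValue_gramSecondSymanzik_neg_setIndicator_eq_neg_zGram hconn hP hcons hgen hℱ, zGram, if_pos hmm]
  push_cast
  ring

/-- **Under generic kinematics the IR leading part of an m.m. `γ` is not zero**: `ℱ_γ(𝒫) · Ψ_{G/γ} ≠ 0` whenever `ℱ(𝒫) ≠ 0`
(a monomial of `ℱ(𝒫)` attaining the face value `−(L_γ+1)` is a monomial of `ℱ_γ(𝒫) · Ψ_{G/γ}` by the companion's coefficient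
identity). [cite: BorinskyMunchTellander2023, Theorem 3.5; Brown2017, Prop. 2.4 / Thm 2.7 eq. (XiIRfact)] -/
theorem gramSecondSymanzikSub_mul_kirchhoffQuot_ne_zero (hconn : IsConnectedEdgeList E) (hP : P.IsSymm)
    (hcons : ∀ u, ∑ v, P u v = 0) {m : Fin N → ℝ} (hgen : IsGeneric P m) (hℱ : gramSecondSymanzik E P m ≠ 0)
    {γ : Finset (Fin N)} (hmm : IsMassMomentumSpanningGram E P m γ) {a : Fin (V + 1)}
    (ha : ∀ v, IsExternal P v → (edgeGraph E γ).Reachable a v) :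
    gramSecondSymanzikSub E γ P m a * kirchhoffQuot E γ ≠ 0 := by
  obtain ⟨d, hd, hdy⟩ := exists_pairing_eq_faceValue hℱ (-setIndicator γ)
  rw [faceValue_gramSecondSymanzik_neg_setIndicator_of_mm hconn hP hcons hgen hℱ hmm, pairing_neg_setIndicator, neg_inj] at hdy
  have hdeg : ∑ e ∈ γ, d e = loopNumber E γ + 1 := by exact_mod_cast hdy
  have key := coeff_eq_coeff_sub_mul_of_gammaDeg_eq hconn hP hcons hmm ha hdeg
  intro h0
  rw [h0, coeff_zero] at key
  exact (mem_support_iff.1 hd) key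

/-- **`ℱ_γ(𝒫) ≠ 0` for an m.m. `γ` under generic kinematics** (`ℱ(𝒫) ≠ 0`). [cite: BorinskyMunchTellander2023, Theorem 3.5; Brown2017, Thm 2.7] -/
theorem gramSecondSymanzikSub_ne_zero (hconn : IsConnectedEdgeList E) (hP : P.IsSymm) (hcons : ∀ u, ∑ v, P u v = 0)
    {m : Fin N → ℝ} (hgen : IsGeneric P m) (hℱ : gramSecondSymanzik E P m ≠ 0) {γ : Finset (Fin N)}
    (hmm : IsMassMomentumSpanningGram E P m γ) {a : Fin (V + 1)} (ha : ∀ v, IsExternal P v → (edgeGraph E γ).Reachable a v) :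
    gramSecondSymanzikSub E γ P m a ≠ 0 := fun h =>
  gramSecondSymanzikSub_mul_kirchhoffQuot_ne_zero hconn hP hcons hgen hℱ hmm ha (by rw [h, zero_mul])

/-- **THEOREM 3.5 / 3.6, m.m. branch, ON THE FACE: under generic kinematics, for EVERY mass-momentum spanning `γ`, the initial
form of `ℱ(𝒫)` on the face exposed by `−1_γ` is `ℱ_γ(𝒫) · Ψ_{G/γ}`** — no side condition (if `ℱ(𝒫) = 0` both sides vanish);
every regime, Minkowski included. Companion of `trunc_gramSecondSymanzik_neg_setIndicator_of_not_isMassMomentumSpanningGram`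
(the other branch: `Ψ_γ · ℱ_{G/γ}(𝒫)`). [cite: BorinskyMunchTellander2023, Theorems 3.5 / 3.6; Brown2017, Thm 2.7 eq. (XiIRfact); Schultka2018, Corollary 4.12; Borinsky2020, Definition 1 and Theorem 32 (proof, tropical.tex l.1217)] -/
theorem trunc_gramSecondSymanzik_neg_setIndicator_of_isMassMomentumSpanningGram (hconn : IsConnectedEdgeList E)
    (hP : P.IsSymm) (hcons : ∀ u, ∑ v, P u v = 0) {m : Fin N → ℝ} (hgen : IsGeneric P m) {γ : Finset (Fin N)}
    (hmm : IsMassMomentumSpanningGram E P m γ) {a : Fin (V + 1)} (ha : ∀ v, IsExternal P v → (edgeGraph E γ).Reachable a v) :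
    trunc (gramSecondSymanzik E P m) (-setIndicator γ) = gramSecondSymanzikSub E γ P m a * kirchhoffQuot E γ := by
  by_cases hℱ : gramSecondSymanzik E P m = 0
  · have hprod : gramSecondSymanzikSub E γ P m a * kirchhoffQuot E γ = 0 := by
      by_contra hne
      obtain ⟨d, hd⟩ := support_nonempty.2 hne
      have key := coeff_eq_coeff_sub_mul_of_gammaDeg_eq hconn hP hcons hmm ha (gammaDeg_of_mem_support_sub_mul_quot hd)
      rw [hℱ, coeff_zero] at key
      exact (mem_support_iff.1 hd) key.symm
    rw [hℱ, trunc_zero, hprod]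
  · exact (faceValue_and_trunc_gramSecondSymanzik_neg_setIndicator_of_mm hconn hP hcons hmm ha
      (gramSecondSymanzikSub_ne_zero hconn hP hcons hgen hℱ hmm ha)).2

/-- The two branches together: under generic kinematics the initial form of `ℱ(𝒫)` on EVERY face `−1_γ` is a product of a
polynomial in the `γ`-variables and one in the remaining variables — `Ψ_γ · ℱ_{G/γ}(𝒫)` or `ℱ_γ(𝒫) · Ψ_{G/γ}` according as `γ`
is m.m. or not (Schultka's product faces `F_{e^γ}P_G = P_γ × P_{G/γ}` for the second Symanzik polytope, read for `𝒫`).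
[cite: Schultka2018, Corollary 4.12 and Proposition 4.11 (1),(4),(5); BorinskyMunchTellander2023, Theorems 3.5 / 3.6; Brown2017, Thm 2.7] -/
theorem trunc_gramSecondSymanzik_neg_setIndicator_eq_ite (hconn : IsConnectedEdgeList E) (hP : P.IsSymm)
    (hcons : ∀ u, ∑ v, P u v = 0) {m : Fin N → ℝ} (hgen : IsGeneric P m) (γ : Finset (Fin N))
    [Decidable (IsMassMomentumSpanningGram E P m γ)] {a : Fin (V + 1)}
    (ha : ∀ v, IsExternal P v → (edgeGraph E γ).Reachable a v) :
    trunc (gramSecondSymanzik E P m) (-setIndicator γ) =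
      if IsMassMomentumSpanningGram E P m γ then gramSecondSymanzikSub E γ P m a * kirchhoffQuot E γ
      else kirchhoffSub E γ * gramSecondSymanzikQuot E γ P m := by
  by_cases hmm : IsMassMomentumSpanningGram E P m γ
  · rw [if_pos hmm]
    exact trunc_gramSecondSymanzik_neg_setIndicator_of_isMassMomentumSpanningGram hconn hP hcons hgen hmm ha
  · rw [if_neg hmm]
    exact trunc_gramSecondSymanzik_neg_setIndicator_of_not_isMassMomentumSpanningGram hconn hP hcons hgen hmm

end Literature.MathematicalPhysics.QuantumFieldTheory.BorinskyMunchTellander2023
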